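import Summits.QuantumAdvantage.QuantumAdvantage.Theorems.CubicForrelationNearExactIsExactKtThreeStep
import Summits.QuantumAdvantage.QuantumAdvantage.Theorems.CubicForrelationNearExactIsExactKtThreeHyperplane

/-!
# Crux `CubicForrelation.NearExactIsExact` (stmt-QuantumAdvantage-14043) — Kasami–Tokura for CUBICS below `2d`, IV: the structure theorem
  (a cubic with `0 < #E < 2^{m−2}` ones is supported inside an affine hyperplane, or `#E = 7·2^{m−5}`) and ALL weights of `RM(3,m)` below
  `2^{m−2}`; on 12 bits: `{0, 512, 768, 896, 960, 992}`

Certificate seat `b2b-cforr-cert` (gen 19).  HONEST FRAMING: a coding-theory BRICK (standard axioms, no `decide`, uniform in the number of bits) —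
an elementary, classification-free proof of the `r = 3` case of Kasami–Tokura's theorem (1970, Thm 1: the words of `RM(r,m)` of weight `< 2d`
are, up to affine equivalence, `x₁⋯x_{r−2}·(x_{r−1}x_r ⊕ ⋯)` or `x₁⋯x_{r−μ}(x_{r−μ+1}⋯x_r ⊕ x_{r+1}⋯x_{r+μ})`; for `r = 3` this says: the support
lies in an affine hyperplane — the word is `x₁·q`, `q` quadratic — unless the word is `x₁x₂x₃ ⊕ x₄x₅x₆`, of weight `1.75d`).  It supersedes,
for the TYPE-O branch of the `n = 12` ladder below `932/1024`, the gap-by-gap moment method of gens 16–18 (`…KtGapCubic`, `…KtGapTwoCubic`: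
gaps `(768,896)`, `(896,960)`): `kt3_weights_twelve` gives every cubic weight below `1024` on 12 bits, in particular the THIRD and FOURTH gaps
`(960, 992)` and `(992, 1024)` (`kt3_gap34_twelve`), which the type-O shape analysis needs from rung `931/1024` down to `928/1024`
(PLAN-N12-931.md: base set `#E ≤ 991`, resp. `< 1024`).  NOT summit progress; no new value of `θ₁₂` by itself.

THE ARGUMENT (`kt3_structure_step` in `…KtThreeStep.lean`, for `c` cubic on `m = k + 1` bits with `0 < w = #E < 2^{m−2}`, assuming the weak weight list on `k` bits):
1. Some derivative `Q = c ⊕ c(·⊕a)` has exactly `2^{m−2}` ones (`kt3_exists_rank_two_derivative`: otherwise all non-period derivatives have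
   `≥ 3·2^{m−3}` ones, contradicting `Σ_a #{c ≠ c(·⊕a)} = 2w(2^m − w)` and the few periods).
2. Its support `U = E Δ (E⊕a)` is `{⟨x,z₁⟩ = b₁} ∩ {⟨x,z₂⟩ = b₂}` (`kt3_minweight_quadratic_cells`), and `E ∩ U = E ∖ (E⊕a)` has `e₀ = 2^{m−3}` points
   (the translation by `a` swaps `E ∩ U` and `U ∖ E`).  Let `e₁, e₂, e₃` count `E` in the three other cells of `(⟨x,z₁⟩, ⟨x,z₂⟩)`.
3. The far sides `{⟨x,z₁⟩ ≠ b₁}`, `{⟨x,z₂⟩ ≠ b₂}`, `{⟨x,z₁⊕z₂⟩ ≠ b₁⊕b₂}` carry `s₁ = e₁+e₃`, `s₂ = e₂+e₃`, `s₃ = e₁+e₂ < 2^{m−3}` points of `E`,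
   each the weight of a cubic on `k` bits (`ktg_restrict`), hence `0`, `e₀/2`, or `≥ 3e₀/4` (hypothesis + powers of two).  If some `s_i = 0`,
   `E` lies in an affine hyperplane.  Otherwise two of them equal `e₀/2 = 2^{m−4}` (as `s₁+s₂+s₃ = 2(w − e₀) < 2e₀`): those sides are
   minimum-weight words of `RM(4,m)` (`c·[affine]`), i.e. FLATS, which any further affine hyperplane cuts in `0`, half, or all
   (`ktg2_minweight_twist_sum`); this pins the common cell to `e₀/4` and `w = 7e₀/4 = 7·2^{m−5}`.
4. `kt3_weights_all` (induction on `m`): a hyperplane-supported cubic has `4w + 2^s = 2^m`, `2s ≥ m+1` (`kt3_hyperplane_weight`); the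
   exceptional weight is `2^{m−2} − 2^{m−5}`; so every cubic with `4w < 2^m` has `w = 0` or `4(w + 2^i) = 2^m` with `m ≤ 2i + 3`
   (and `8·2^i ≤ 2^m`) — the weak list feeds the next level.

Main statements: `kt3_weights_weak_all`, `kt3_structure` (all `m`), `kt3_weights_all` (all `m`, sharp), `kt3_weights_twelve` (`w < 1024 ⇒
w ∈ {0,512,768,896,960,992}`), `kt3_gap34_twelve` (no cubic on 12 bits has `960 < w < 1024` other than `w = 992`), `kt3_structure_twelve`,
`kt3_weights_fourteen` (`w < 4096 ⇒ w ∈ {0,2048,3072,3584,3840,3968,4032}`).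

References: T. Kasami, N. Tokura, *On the weight structure of Reed–Muller codes*, IEEE Trans. IT 16 (1970) 752–759, Thm 1; F. J. MacWilliams,
N. J. A. Sloane (1977) Ch. 13 §4, Ch. 15 §3; C. Carlet (2021) §4.1 (statement).  The proof here is this seat's own (the 1970 proof inducts on
`f = g ⊕ x_m h`; Berlekamp–Sloane 1969 use power sums in `GF(2^m)`).  Axioms: the standard three.
-/

set_option linter.dupNamespace false -- D-0017: single-problem summit ⇒ `QuantumAdvantage.QuantumAdvantage` by design

noncomputable section

namespace Summit.QuantumAdvantage.QuantumAdvantage.Theorems.CubicForrelation.NearExactIsExact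

open Finset
open Literature.Computability.QuantumComplexity
open Literature.Computability.QuantumComplexity.BuzetChailloux (bxor zeroVec bxor_bxor_cancel_left bxor_zeroVec zeroVec_bxor bxor_comm
  bxor_self twist_zeroVec_right twist_bxor_right sum_twist_left)
open Literature.Computability.QuantumComplexity.DerivativeWalsh (W twist_bxor_left)
open Literature.Computability.QuantumComplexity.Simon (twist_eq_one_or)
open Summit.QuantumAdvantage.QuantumAdvantage.Theorems.SignedCubicForrelationNotPrBPP (knf_isDegLeFun_ip)

/-! ### The weights of `RM(3,m)` below `2^{m-2}`, all `m` -/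

/-- **The weak weight list, all `m`** (the induction): a Boolean function of degree `≤ 3` on `m` bits with `4·#E < 2^m` has `#E = 0` or
`4(#E + 2^i) = 2^m` for some `i` with `8·2^i ≤ 2^m` (i.e. `#E = 2^{m−2} − 2^i`, `i ≤ m − 3`). [this work; cite: KasamiTokura1970, Thm 1] -/
theorem kt3_weights_weak_all : ∀ (m : ℕ) (c : (Fin m → Bool) → Bool), IsDegLeFun 3 c →
    4 * #(univ.filter fun x => c x = true) < 2 ^ m →
      #(univ.filter fun x => c x = true) = 0 ∨
        ∃ i, 4 * (#(univ.filter fun x => c x = true) + 2 ^ i) = 2 ^ m ∧ 8 * 2 ^ i ≤ 2 ^ m := by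
  intro m
  induction m with
  | zero => intro c _ h4; left; simp only [pow_zero] at h4; omega
  | succ k ih =>
    intro c hc h4
    rcases Nat.eq_zero_or_pos #(univ.filter fun x => c x = true) with h0 | hpos
    · exact Or.inl h0
    right
    rcases kt3_structure_step k ih c hc hpos h4 with ⟨z, b, hz, hE⟩ | hex
    · obtain ⟨s, hs, hs2⟩ := kt3_hyperplane_weight c hc h4 z hz b hE
      -- `s ≥ 2` since `4 ∣ 2^s` and `s < k + 1`
      have hs_lt : 2 ^ s < 2 ^ (k + 1) := by omega
      have hslt : s < k + 1 := (Nat.pow_lt_pow_iff_right (by norm_num)).1 hs_lt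
      have hk2 : 2 ≤ k + 1 := by omega
      obtain ⟨j, hj⟩ : ∃ j, k + 1 = j + 2 := ⟨k + 1 - 2, by omega⟩
      have h4dvd : 4 ∣ 2 ^ s := by
        have h1 : 4 ∣ 2 ^ (k + 1) := by rw [hj, pow_add]; exact dvd_mul_left _ _
        have h2 : 2 ^ s = 2 ^ (k + 1) - 4 * #(univ.filter fun x => c x = true) := by omega
        rw [h2]; exact Nat.dvd_sub h1 (dvd_mul_right _ _)
      have hs2' : 2 ≤ s := by
        by_contra hcon
        interval_cases s <;> norm_num at h4dvd
      obtain ⟨i, rfl⟩ : ∃ i, s = i + 2 := ⟨s - 2, by omega⟩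
      refine ⟨i, ?_, ?_⟩
      · rw [pow_add] at hs; omega
      · have : 2 ^ (i + 2 + 1) ≤ 2 ^ (k + 1) := Nat.pow_le_pow_right (by norm_num) (by omega)
        rw [pow_add, pow_add] at this
        have e : 2 ^ (i + 2 + 1) = 8 * 2 ^ i := by ring
        omega
    · -- the exceptional weight `7·2^{m−5}`
      have hk5 : 5 ≤ k + 1 := by
        rcases Nat.lt_or_ge k 4 with hk | hk
        · exfalso; interval_cases k <;> norm_num at hex <;> omega
        · omega
      obtain ⟨j, hj⟩ : ∃ j, k + 1 = j + 5 := ⟨k + 1 - 5, by omega⟩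
      refine ⟨j, ?_, ?_⟩
      · have e : 2 ^ (k + 1) = 32 * 2 ^ j := by rw [hj, pow_add]; ring
        rw [e] at hex ⊢; omega
      · have e : 2 ^ (k + 1) = 32 * 2 ^ j := by rw [hj, pow_add]; ring
        rw [e]; omega

/-- **Kasami–Tokura for cubics, structure, all `m`.**  A Boolean function of degree `≤ 3` on `m` bits with `0 < #E` and `4·#E < 2^m` has its
support inside an affine hyperplane `{⟨x,z⟩ = b}` (`z ≠ 0`), or `32·#E = 7·2^m`. [this work; cite: KasamiTokura1970, Thm 1] -/
theorem kt3_structure {m : ℕ} (c : (Fin m → Bool) → Bool) (hc : IsDegLeFun 3 c)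
    (hpos : 0 < #(univ.filter fun x => c x = true)) (h4 : 4 * #(univ.filter fun x => c x = true) < 2 ^ m) :
    (∃ (z : Fin m → Bool) (b : Bool), z ≠ zeroVec ∧
        ∀ x, c x = true → decide (Odd #(univ.filter fun i => (x i && z i) = true)) = b) ∨
      32 * #(univ.filter fun x => c x = true) = 7 * 2 ^ m := by
  cases m with
  | zero => simp only [pow_zero] at h4; omega
  | succ k => exact kt3_structure_step k (kt3_weights_weak_all k) c hc hpos h4

/-- **The weights of `RM(3,m)` below `2^{m−2}`, all `m` (sharp).**  A Boolean function of degree `≤ 3` on `m` bits with `4·#E < 2^m` has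
`#E = 0`, or `4·#E + 2^s = 2^m` with `m + 1 ≤ 2s` (support in a hyperplane: `#E = 2^{m−2} − 2^{s−2}`, `s ≥ (m+1)/2`), or `32·#E = 7·2^m`
(the word `x₁x₂x₃ ⊕ x₄x₅x₆`).  [this work; cite: KasamiTokura1970, Thm 1] -/
theorem kt3_weights_all {m : ℕ} (c : (Fin m → Bool) → Bool) (hc : IsDegLeFun 3 c)
    (h4 : 4 * #(univ.filter fun x => c x = true) < 2 ^ m) :
    #(univ.filter fun x => c x = true) = 0 ∨
      (∃ s, 4 * #(univ.filter fun x => c x = true) + 2 ^ s = 2 ^ m ∧ m + 1 ≤ 2 * s) ∨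
      32 * #(univ.filter fun x => c x = true) = 7 * 2 ^ m := by
  rcases Nat.eq_zero_or_pos #(univ.filter fun x => c x = true) with h0 | hpos
  · exact Or.inl h0
  rcases kt3_structure c hc hpos h4 with ⟨z, b, hz, hE⟩ | hex
  · exact Or.inr (Or.inl (kt3_hyperplane_weight c hc h4 z hz b hE))
  · exact Or.inr (Or.inr hex)

/-! ### Twelve and fourteen bits -/

/-- **The weights of `RM(3,12)` below `1024`**: a Boolean function of degree `≤ 3` on 12 bits with fewer than `1024` ones has
`0, 512, 768, 896, 960` or `992` ones (Kasami–Tokura: `2d(1 − 2^{−μ})`, `1 ≤ μ ≤ 5`).  In particular the third and fourth gaps `(960, 992)`,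
`(992, 1024)` needed by the type-O branch of the `n = 12` ladder below `932/1024`. [this work; cite: KasamiTokura1970, Thm 1] -/
theorem kt3_weights_twelve (c : (Fin (6 + 6) → Bool) → Bool) (hc : IsDegLeFun 3 c)
    (h : #(univ.filter fun x => c x = true) < 1024) :
    #(univ.filter fun x => c x = true) = 0 ∨ #(univ.filter fun x => c x = true) = 512 ∨
      #(univ.filter fun x => c x = true) = 768 ∨ #(univ.filter fun x => c x = true) = 896 ∨
      #(univ.filter fun x => c x = true) = 960 ∨ #(univ.filter fun x => c x = true) = 992 := by
  have hN : (2 : ℕ) ^ (6 + 6) = 4096 := by norm_num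
  rcases kt3_weights_all c hc (by rw [hN]; omega) with h0 | ⟨s, hs, hs2⟩ | hex
  · exact Or.inl h0
  · rw [hN] at hs
    have hsle : s ≤ 12 := by
      by_contra hcon
      have : 2 ^ 13 ≤ 2 ^ s := Nat.pow_le_pow_right (by norm_num) (by omega)
      omega
    interval_cases s <;> omega
  · rw [hN] at hex; omega

/-- **The third and fourth Kasami–Tokura gaps on 12 bits**: no Boolean function of degree `≤ 3` on 12 bits has a number of ones strictly
between `960` and `992`, or strictly between `992` and `1024`. [this work; cite: KasamiTokura1970, Thm 1] -/
theorem kt3_gap34_twelve (c : (Fin (6 + 6) → Bool) → Bool) (hc : IsDegLeFun 3 c) :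
    ¬ (960 < #(univ.filter fun x => c x = true) ∧ #(univ.filter fun x => c x = true) < 992) ∧
      ¬ (992 < #(univ.filter fun x => c x = true) ∧ #(univ.filter fun x => c x = true) < 1024) := by
  constructor
  · rintro ⟨h1, h2⟩
    rcases kt3_weights_twelve c hc (by omega) with h | h | h | h | h | h <;> omega
  · rintro ⟨h1, h2⟩
    rcases kt3_weights_twelve c hc h2 with h | h | h | h | h | h <;> omega

/-- **Structure on 12 bits**: a Boolean function of degree `≤ 3` on 12 bits with `0 < #E < 1024` ones is supported inside an affine
hyperplane `{⟨x,z⟩ = b}`, `z ≠ 0` (so it is `x·q` with `q` quadratic on the hyperplane), unless `#E = 896`.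
[this work; cite: KasamiTokura1970, Thm 1] -/
theorem kt3_structure_twelve (c : (Fin (6 + 6) → Bool) → Bool) (hc : IsDegLeFun 3 c)
    (hpos : 0 < #(univ.filter fun x => c x = true)) (h : #(univ.filter fun x => c x = true) < 1024) :
    (∃ (z : Fin (6 + 6) → Bool) (b : Bool), z ≠ zeroVec ∧
        ∀ x, c x = true → decide (Odd #(univ.filter fun i => (x i && z i) = true)) = b) ∨
      #(univ.filter fun x => c x = true) = 896 := by
  have hN : (2 : ℕ) ^ (6 + 6) = 4096 := by norm_num
  rcases kt3_structure c hc hpos (by rw [hN]; omega) with h1 | hex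
  · exact Or.inl h1
  · rw [hN] at hex; exact Or.inr (by omega)

/-- **The weights of `RM(3,14)` below `4096`**: a Boolean function of degree `≤ 3` on 14 bits with fewer than `4096` ones has
`0, 2048, 3072, 3584, 3840, 3968` or `4032` ones. [this work; cite: KasamiTokura1970, Thm 1] -/
theorem kt3_weights_fourteen (c : (Fin (7 + 7) → Bool) → Bool) (hc : IsDegLeFun 3 c)
    (h : #(univ.filter fun x => c x = true) < 4096) :
    #(univ.filter fun x => c x = true) = 0 ∨ #(univ.filter fun x => c x = true) = 2048 ∨
      #(univ.filter fun x => c x = true) = 3072 ∨ #(univ.filter fun x => c x = true) = 3584 ∨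
      #(univ.filter fun x => c x = true) = 3840 ∨ #(univ.filter fun x => c x = true) = 3968 ∨
      #(univ.filter fun x => c x = true) = 4032 := by
  have hN : (2 : ℕ) ^ (7 + 7) = 16384 := by norm_num
  rcases kt3_weights_all c hc (by rw [hN]; omega) with h0 | ⟨s, hs, hs2⟩ | hex
  · exact Or.inl h0
  · rw [hN] at hs
    have hsle : s ≤ 14 := by
      by_contra hcon
      have : 2 ^ 15 ≤ 2 ^ s := Nat.pow_le_pow_right (by norm_num) (by omega)
      omega
    interval_cases s <;> omega
  · rw [hN] at hex; omega

end Summit.QuantumAdvantage.QuantumAdvantage.Theorems.CubicForrelation.NearExactIsExact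

end
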